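import Mathlib
import Summits.ValiantsHypothesis.ValiantsHypothesis.Theorems.NNDivisionHard.Negative.BlindCubeIdentity
import Summits.ValiantsHypothesis.ValiantsHypothesis.Theorems.NNDivisionHard.Negative.CliqueRowLawFalse
import Summits.ValiantsHypothesis.ValiantsHypothesis.Theorems.FifoMatchingNNDivisionHardLowDimFace
import Literature.Barriers.PneNP.TSPExtensionComplexityFaces
import Literature.Barriers.PneNP.ExtendedFormulationLinearImage

/-!
# The diagonally-tilted clique-row law `C⁺_diag` is false (crux `FifoMatching.NNDivisionHard`, stmt-ValiantsHypothesis-21181; Negative lane)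
val-idea-crit-9 g2 (critic of record, WAVE-6 KILL NOTE N18).  `CliqueRowBlind.lean` rev 6 §4 (val-idea-39 g3) types the row family
`diagTilted` — rows `(a, σ)`, functional `udRow a + flat (diagonal σ)`, right-hand side `1 + Σ_i max(σ_i, 0)` — and its law C⁺_diag
(second link of `law_chain`).  It is FALSE for every `n ≥ 2`: on the ZERO-DIAGONAL boosted cube `Q∘ = conv{q_P}`, `(q_P)_ii = 0`,
`(q_P)_im = n²(1 − P_i − P_m) + n|P|` (`i ≠ m`; affine image of `[0,1]ⁿ`, `xc ≤ 2n`), every diagonal tilt is inert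
(`⟨flat (diagonal σ), q_P⟩ = 0`), the clique rows have the private maximiser `P = a` (`m_a = (k−1)nk(n−k)`, recourse
`(k−1)n[(2n−k)|a∖P| + k|P∖a|]`, `k = |a|`), and the augmented slack `(1 − |a∩b|)² + recourse + Σ_i (σ_i⁺(1 − b_i) + σ_i⁻ b_i)`
factors nonnegatively through `2n² + 7n + 3` slots (`blind_rankPlus_le` at `λ = n` plus `4n + 1` linear slots) `< T 2 n`.
The negated law is stated INLINE (`diagTilted.Law` unfolded over the port's `ud*`; `T` written out); checked `exact`-equal to the
workfile's decl.  Theorems and concrete data only; VP ≠ VNP is NOT proved; the crux stays OPEN.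
-/

namespace Summit.ValiantsHypothesis.Theorems.NNDivisionHardNegative.DiagTilted

open Matrix Finset
open Literature.Barriers.PneNP (HasEFOfSize)
open Literature.Combinatorics.Optimization.FixedSizePsdRank (flat vecOuter)
open Summit.ValiantsHypothesis.ValiantsHypothesis.Theorems.FifoMatching.XcDivision
  (udInd udPt udRow udInd_apply udInd_sq udInd_inter ud_data udRow_dotProduct_flat_diagonal flat_dotProduct_flat)
open Summit.ValiantsHypothesis.Theorems.NNDivisionHardNegative.BlindCubeIdentity (BIdx card_BIdx blind_rankPlus_le)
open Summit.ValiantsHypothesis.Theorems.NNDivisionHardNegative.CliqueRowBlind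
  (unitCube hasEFOfSize_unitCube convexHull_range_udInd sum_udInd_univ sum_udInd_mem)
open scoped Pointwise

/-! ## §1 The zero-diagonal boosted cube `Q∘` -/
/-- the matrix `q_P`: zero diagonal, off-diagonal entries `n²(1 − P_i − P_m) + n|P|`. -/
def qOffMat (n : ℕ) (P : Finset (Fin n)) : Matrix (Fin n) (Fin n) ℝ := fun i m =>
  if i = m then 0 else (n : ℝ) ^ 2 * (1 - udInd P i - udInd P m) + (n : ℝ) * (P.card : ℝ)
/-- the vertex `q_P` of `Q∘`, flattened. -/
def qOff {n : ℕ} (P : Finset (Fin n)) : Fin (n * n) → ℝ := flat (qOffMat n P)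

/-- ★ diagonal tilts are INERT on `Q∘`: `⟨flat (diagonal σ), q_P⟩ = 0`. -/
theorem flat_diagonal_dotProduct_qOff {n : ℕ} (σ : Fin n → ℝ) (P : Finset (Fin n)) :
    flat (Matrix.diagonal σ) ⬝ᵥ qOff P = 0 := by
  classical
  rw [qOff, flat_dotProduct_flat]
  refine Finset.sum_eq_zero fun i _ => Finset.sum_eq_zero fun j _ => ?_
  by_cases h : i = j
  · subst h; simp [qOffMat]
  · rw [Matrix.diagonal_apply_ne _ h, zero_mul]
/-- the tilted row sees `q_P` exactly as the untilted clique row does. -/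
theorem rho_dotProduct_qOff {n : ℕ} (a : Finset (Fin n)) (σ : Fin n → ℝ) (P : Finset (Fin n)) :
    (udRow a + flat (Matrix.diagonal σ)) ⬝ᵥ qOff P = udRow a ⬝ᵥ qOff P := by
  rw [add_dotProduct, flat_diagonal_dotProduct_qOff, add_zero]
/-- `𝟙_{Pᶜ} = 1 − 𝟙_P`. -/
theorem udInd_compl {n : ℕ} (P : Finset (Fin n)) (i : Fin n) : udInd Pᶜ i = 1 - udInd P i := by
  rw [udInd_apply, udInd_apply]; by_cases h : i ∈ P <;> simp [h]
/-- `𝟙_{univ} = 1`. -/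
theorem udInd_univ {n : ℕ} (i : Fin n) : udInd (Finset.univ : Finset (Fin n)) i = 1 := by
  rw [udInd_apply, if_pos (Finset.mem_univ i)]
/-- `q_P = n²(𝟙_{Pᶜ}𝟙_{Pᶜ}ᵀ − 𝟙_P𝟙_Pᵀ) + n|P|·𝟙𝟙ᵀ + diag(n²(2·𝟙_P − 1) − n|P|)`. -/
theorem qOff_eq {n : ℕ} (P : Finset (Fin n)) :
    qOff P = (n : ℝ) ^ 2 • (udPt Pᶜ - udPt P) + ((n : ℝ) * (P.card : ℝ)) • udPt (Finset.univ : Finset (Fin n))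
      + flat (Matrix.diagonal fun i => (n : ℝ) ^ 2 * (2 * udInd P i - 1) - (n : ℝ) * (P.card : ℝ)) := by
  funext p
  simp only [qOff, qOffMat, udPt, flat, vecOuter, Pi.add_apply, Pi.sub_apply, Pi.smul_apply, smul_eq_mul,
    udInd_compl, udInd_univ]
  by_cases h : (finProdFinEquiv.symm p).1 = (finProdFinEquiv.symm p).2
  · rw [if_pos h, h, Matrix.diagonal_apply_eq]; ring
  · rw [if_neg h, Matrix.diagonal_apply_ne _ h]; ring

/-- ★ `⟨udRow a, q_P⟩ = −(k − 1)·n·(nk − 2n|a∩P| + k|P|)` (`k = |a|`; only the off-diagonal weights `−a_i a_m` act). -/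
theorem udRow_dotProduct_qOff {n : ℕ} (a P : Finset (Fin n)) :
    udRow a ⬝ᵥ qOff P = -(((a.card : ℝ) - 1) * n * (n * a.card - 2 * n * (a ∩ P).card + a.card * P.card)) := by
  classical
  obtain ⟨-, -, slack, -⟩ := ud_data n
  have h1 : udRow a ⬝ᵥ udPt Pᶜ = 1 - (1 - ((a ∩ Pᶜ).card : ℝ)) ^ 2 := by linarith [slack a Pᶜ]
  have h2 : udRow a ⬝ᵥ udPt P = 1 - (1 - ((a ∩ P).card : ℝ)) ^ 2 := by linarith [slack a P]
  have h3 : udRow a ⬝ᵥ udPt (Finset.univ : Finset (Fin n)) = 1 - (1 - (a.card : ℝ)) ^ 2 := by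
    have := slack a Finset.univ; rw [Finset.inter_univ] at this; linarith
  have h4 : udRow a ⬝ᵥ flat (Matrix.diagonal fun i => (n : ℝ) ^ 2 * (2 * udInd P i - 1) - (n : ℝ) * (P.card : ℝ)) =
      (n : ℝ) ^ 2 * (2 * (a ∩ P).card - a.card) - n * P.card * a.card := by
    rw [udRow_dotProduct_flat_diagonal, Finset.sum_sub_distrib, ← Finset.mul_sum, Finset.sum_sub_distrib,
      ← Finset.mul_sum, sum_udInd_mem, Finset.sum_const, Finset.sum_const, nsmul_eq_mul, nsmul_eq_mul]
    ring
  have hc : ((a ∩ Pᶜ).card : ℝ) = a.card - (a ∩ P).card := by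
    have : (a ∩ Pᶜ).card + (a ∩ P).card = a.card := by
      rw [← Finset.card_union_of_disjoint]
      · congr 1; ext i; simp only [Finset.mem_union, Finset.mem_inter, Finset.mem_compl]; tauto
      · exact Finset.disjoint_left.2 fun i hi hi' =>
          (Finset.mem_compl.1 (Finset.mem_inter.1 hi).2) (Finset.mem_inter.1 hi').2
    have := congrArg (fun k : ℕ => (k : ℝ)) this
    push_cast at this; linarith
  rw [qOff_eq, dotProduct_add, dotProduct_add, dotProduct_smul, dotProduct_smul, dotProduct_sub, smul_eq_mul,
    smul_eq_mul, h1, h2, h3, h4, hc]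
  ring
/-- the row maximum `m_a = (k − 1)·n·k·(n − k)`. -/
def mval (n : ℕ) (a : Finset (Fin n)) : ℝ := ((a.card : ℝ) - 1) * n * a.card * (n - a.card)
/-- `m_a` is attained at `P = a`. -/
theorem udRow_dotProduct_qOff_self {n : ℕ} (a : Finset (Fin n)) : udRow a ⬝ᵥ qOff a = mval n a := by
  rw [udRow_dotProduct_qOff, Finset.inter_self, mval]; ring
/-- `m_a` bounds the row: the recourse `(k−1)n[(2n−k)|a∖P| + k|P∖a|]` is nonnegative. -/
theorem udRow_dotProduct_qOff_le {n : ℕ} (a P : Finset (Fin n)) : udRow a ⬝ᵥ qOff P ≤ mval n a := by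
  classical
  rw [udRow_dotProduct_qOff, mval]
  have hk : (a.card : ℝ) ≤ n := by
    have := Finset.card_le_univ a; rw [Fintype.card_fin] at this; exact_mod_cast this
  have ht1 : ((a ∩ P).card : ℝ) ≤ a.card := by exact_mod_cast Finset.card_le_card Finset.inter_subset_left
  have ht2 : ((a ∩ P).card : ℝ) ≤ P.card := by exact_mod_cast Finset.card_le_card Finset.inter_subset_right
  rcases a.eq_empty_or_nonempty with rfl | hne
  · simp
  · have hk1 : (1 : ℝ) ≤ a.card := by exact_mod_cast hne.card_pos
    have key : ((a.card : ℝ) - 1) * n * a.card * (n - a.card)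
        - -(((a.card : ℝ) - 1) * n * (n * a.card - 2 * n * (a ∩ P).card + a.card * P.card))
        = ((a.card : ℝ) - 1) * n * ((2 * n - a.card) * (a.card - (a ∩ P).card) + a.card * (P.card - (a ∩ P).card)) := by
      ring
    have hnn : 0 ≤ ((a.card : ℝ) - 1) * n * ((2 * n - a.card) * (a.card - (a ∩ P).card)
        + a.card * (P.card - (a ∩ P).card)) :=
      mul_nonneg (mul_nonneg (by linarith) (Nat.cast_nonneg n))
        (add_nonneg (mul_nonneg (by linarith) (by linarith)) (mul_nonneg (by linarith) (by linarith)))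
    linarith

/-! ## §2 The explicit nonnegative factorization of the augmented `diagTilted` slack of `COR(n) + Q∘` -/
/-- slots: the `2n² + 3n + 2` slots of `blind_rankPlus_le`, two surplus recourse families, the two box families, one constant. -/
abbrev DIdx (n : ℕ) := BIdx n ⊕ Fin n ⊕ Fin n ⊕ Fin n ⊕ Fin n ⊕ Unit
/-- `|DIdx n| = 2n² + 7n + 3`. -/
theorem card_DIdx (n : ℕ) : Fintype.card (DIdx n) = 2 * n ^ 2 + 7 * n + 3 := by
  simp [DIdx, BIdx, Fintype.card_sum, Fintype.card_prod, Fintype.card_fin]; ring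
/-- a sum over `DIdx n`, split by slot family. -/
theorem sum_DIdx {n : ℕ} (f : DIdx n → ℝ) :
    ∑ idx, f idx = ∑ idx, f (Sum.inl idx) + ∑ i, f (Sum.inr (Sum.inl i)) + ∑ i, f (Sum.inr (Sum.inr (Sum.inl i)))
      + ∑ i, f (Sum.inr (Sum.inr (Sum.inr (Sum.inl i)))) + ∑ i, f (Sum.inr (Sum.inr (Sum.inr (Sum.inr (Sum.inl i)))))
      + f (Sum.inr (Sum.inr (Sum.inr (Sum.inr (Sum.inr ()))))) := by
  simp only [Fintype.sum_sum_type, Fintype.sum_unique, PUnit.default_eq_unit]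
  ring
/-- surplus coefficient of `|a ∖ P|`: `n((k−1)(2n−k) − k)`. -/
def c₁ (n : ℕ) (a : Finset (Fin n)) : ℝ := (n : ℝ) * (((a.card : ℝ) - 1) * (2 * n - a.card) - a.card)
/-- surplus coefficient of `|P ∖ a|`: `nk(k−2)`. -/
def c₂ (n : ℕ) (a : Finset (Fin n)) : ℝ := (n : ℝ) * a.card * ((a.card : ℝ) - 2)
/-- row factors of the row `(a, σ)`. -/
def rowU (n : ℕ) (U₀ : Finset (Fin n) → BIdx n → ℝ) (a : Finset (Fin n)) (σ : Fin n → ℝ) : DIdx n → ℝ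
  | Sum.inl idx => if 2 ≤ a.card then U₀ a idx else 0
  | Sum.inr (Sum.inl i) => if 2 ≤ a.card then c₁ n a * udInd a i else 0
  | Sum.inr (Sum.inr (Sum.inl i)) => if 2 ≤ a.card then c₂ n a * (1 - udInd a i) else 0
  | Sum.inr (Sum.inr (Sum.inr (Sum.inl i))) => max (σ i) 0 + (if 2 ≤ a.card then 0 else udInd a i)
  | Sum.inr (Sum.inr (Sum.inr (Sum.inr (Sum.inl i)))) => max (-σ i) 0
  | Sum.inr (Sum.inr (Sum.inr (Sum.inr (Sum.inr _)))) => if 2 ≤ a.card then 0 else 1 - (a.card : ℝ)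
/-- column factors of the column `(b, P)`. -/
def colV (n : ℕ) (V₀ : Finset (Fin n) × Finset (Fin n) → BIdx n → ℝ) (b P : Finset (Fin n)) : DIdx n → ℝ
  | Sum.inl idx => V₀ (b, P) idx
  | Sum.inr (Sum.inl i) => 1 - udInd P i
  | Sum.inr (Sum.inr (Sum.inl i)) => udInd P i
  | Sum.inr (Sum.inr (Sum.inr (Sum.inl i))) => 1 - udInd b i
  | Sum.inr (Sum.inr (Sum.inr (Sum.inr (Sum.inl i)))) => udInd b i
  | Sum.inr (Sum.inr (Sum.inr (Sum.inr (Sum.inr _)))) => 1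
/-- `0 ≤ 𝟙_a(i)`. -/
theorem udInd_nonneg' {n : ℕ} (a : Finset (Fin n)) (i : Fin n) : 0 ≤ udInd a i := by
  rw [udInd_apply]; split_ifs <;> norm_num
/-- `𝟙_a(i) ≤ 1`. -/
theorem udInd_le_one' {n : ℕ} (a : Finset (Fin n)) (i : Fin n) : udInd a i ≤ 1 := by
  rw [udInd_apply]; split_ifs <;> norm_num
/-- `c₁ ≥ 0` for `2 ≤ k ≤ n`, `n ≥ 2`: `(k−1)(2n−k) − k = (k−1)(n−k) + (k−2)(n−1) + (n−2)`. -/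
theorem c₁_nonneg {n : ℕ} (hn : 2 ≤ n) {a : Finset (Fin n)} (ha : 2 ≤ a.card) : 0 ≤ c₁ n a := by
  have hk : (a.card : ℝ) ≤ n := by
    have := Finset.card_le_univ a; rw [Fintype.card_fin] at this; exact_mod_cast this
  have h2 : (2 : ℝ) ≤ a.card := by exact_mod_cast ha
  have hn2 : (2 : ℝ) ≤ n := by exact_mod_cast hn
  have key : ((a.card : ℝ) - 1) * (2 * n - a.card) - a.card
      = ((a.card : ℝ) - 1) * (n - a.card) + ((a.card : ℝ) - 2) * (n - 1) + (n - 2) := by ring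
  unfold c₁
  rw [key]
  exact mul_nonneg (by linarith) (add_nonneg (add_nonneg (mul_nonneg (by linarith) (by linarith))
    (mul_nonneg (by linarith) (by linarith))) (by linarith))
/-- `c₂ ≥ 0` for `k ≥ 2`. -/
theorem c₂_nonneg {n : ℕ} {a : Finset (Fin n)} (ha : 2 ≤ a.card) : 0 ≤ c₂ n a := by
  have h2 : (2 : ℝ) ≤ a.card := by exact_mod_cast ha
  unfold c₂
  exact mul_nonneg (mul_nonneg (Nat.cast_nonneg n) (by linarith)) (by linarith)
/-- row factors are nonnegative (`n ≥ 2`). -/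
theorem rowU_nonneg {n : ℕ} (hn : 2 ≤ n) {U₀ : Finset (Fin n) → BIdx n → ℝ} (hU₀ : ∀ a idx, 0 ≤ U₀ a idx)
    (a : Finset (Fin n)) (σ : Fin n → ℝ) (idx : DIdx n) : 0 ≤ rowU n U₀ a σ idx := by
  have h0 := udInd_nonneg' a; have h1 := udInd_le_one' a
  rcases idx with idx | i | i | i | i | u <;> simp only [rowU]
  · split_ifs
    · exact hU₀ a idx
    · exact le_rfl
  · split_ifs with h
    · exact mul_nonneg (c₁_nonneg hn h) (h0 i)
    · exact le_rfl
  · split_ifs with h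
    · exact mul_nonneg (c₂_nonneg h) (by linarith [h1 i])
    · exact le_rfl
  · split_ifs
    · exact add_nonneg (le_max_right _ _) le_rfl
    · exact add_nonneg (le_max_right _ _) (h0 i)
  · exact le_max_right _ _
  · split_ifs with h
    · exact le_rfl
    · have : (a.card : ℝ) ≤ 1 := by exact_mod_cast (by omega : a.card ≤ 1)
      linarith
/-- column factors are nonnegative. -/
theorem colV_nonneg {n : ℕ} {V₀ : Finset (Fin n) × Finset (Fin n) → BIdx n → ℝ} (hV₀ : ∀ c idx, 0 ≤ V₀ c idx)
    (b P : Finset (Fin n)) (idx : DIdx n) : 0 ≤ colV n V₀ b P idx := by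
  rcases idx with idx | i | i | i | i | u <;> simp only [colV]
  · exact hV₀ _ idx
  · linarith [udInd_le_one' P i]
  · exact udInd_nonneg' P i
  · linarith [udInd_le_one' b i]
  · exact udInd_nonneg' b i
  · norm_num
/-- `Σ_{i∈b} σ_i = Σ_i σ_i⁺ b_i − Σ_i σ_i⁻ b_i`. -/
theorem sum_mem_eq_box {n : ℕ} (σ : Fin n → ℝ) (b : Finset (Fin n)) :
    ∑ i ∈ b, σ i = ∑ i, max (σ i) 0 * udInd b i - ∑ i, max (-σ i) 0 * udInd b i := by
  classical
  rw [← Finset.sum_sub_distrib]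
  have : ∀ i, max (σ i) 0 * udInd b i - max (-σ i) 0 * udInd b i = if i ∈ b then σ i else 0 := by
    intro i
    rw [← sub_mul, max_zero_sub_max_neg_zero_eq_self, udInd_apply]
    split_ifs <;> simp
  simp only [this]
  rw [Finset.sum_ite_mem, Finset.univ_inter]
/-- `Σ_i 𝟙_a(i)(1 − 𝟙_P(i)) = |a ∖ P|`. -/
theorem sum_udInd_mul_one_sub {n : ℕ} (a P : Finset (Fin n)) :
    ∑ i, udInd a i * (1 - udInd P i) = (a.card : ℝ) - (a ∩ P).card := by
  simp only [mul_sub, mul_one, Finset.sum_sub_distrib, sum_udInd_univ, udInd_inter]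
/-- `Σ_i (1 − 𝟙_a(i))𝟙_P(i) = |P ∖ a|`. -/
theorem sum_one_sub_udInd_mul {n : ℕ} (a P : Finset (Fin n)) :
    ∑ i, (1 - udInd a i) * udInd P i = (P.card : ℝ) - (a ∩ P).card := by
  simp only [sub_mul, one_mul, Finset.sum_sub_distrib, sum_udInd_univ, udInd_inter]

/-- ★ **the factorization**: for `n ≥ 2`, the augmented `diagTilted` slack of `COR(n) + Q∘` — rows `(a, σ)`, columns
`(b, P)`, row value `1 + Σ_i max(σ_i,0) + m_a` — factors nonnegatively through `DIdx n` (`2n² + 7n + 3` slots). -/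
theorem slack_factorization (n : ℕ) (hn : 2 ≤ n) :
    ∃ (U : Finset (Fin n) × (Fin n → ℝ) → DIdx n → ℝ) (V : Finset (Fin n) × Finset (Fin n) → DIdx n → ℝ),
      (∀ a idx, 0 ≤ U a idx) ∧ (∀ c idx, 0 ≤ V c idx) ∧
      ∀ (a : Finset (Fin n) × (Fin n → ℝ)) (b P : Finset (Fin n)),
        (1 + ∑ i, max (a.2 i) 0 + mval n a.1) - (udRow a.1 + flat (Matrix.diagonal a.2)) ⬝ᵥ (udPt b + qOff P)
          = ∑ idx, U a idx * V (b, P) idx := by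
  classical
  obtain ⟨U₀, V₀, hU₀, hV₀, hid⟩ := blind_rankPlus_le n n (by exact_mod_cast (by omega : 1 ≤ n)) (by linarith)
  refine ⟨fun a => rowU n U₀ a.1 a.2, fun c => colV n V₀ c.1 c.2, fun a idx => rowU_nonneg hn hU₀ a.1 a.2 idx,
    fun c idx => colV_nonneg hV₀ c.1 c.2 idx, ?_⟩
  rintro ⟨a, σ⟩ b P
  obtain ⟨-, -, slack, diag⟩ := ud_data n
  have hD : udRow a ⬝ᵥ udPt b = 1 - (1 - ((a ∩ b).card : ℝ)) ^ 2 := by linarith [slack a b]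
  have hLHS : (1 + ∑ i, max (σ i) 0 + mval n a) - (udRow a + flat (Matrix.diagonal σ)) ⬝ᵥ (udPt b + qOff P)
      = (1 - ((a ∩ b).card : ℝ)) ^ 2 + (mval n a - udRow a ⬝ᵥ qOff P)
        + (∑ i, max (σ i) 0 - ∑ i, max (σ i) 0 * udInd b i + ∑ i, max (-σ i) 0 * udInd b i) := by
    rw [dotProduct_add, add_dotProduct, add_dotProduct, flat_diagonal_dotProduct_qOff, diag σ b, sum_mem_eq_box σ b, hD]
    ring
  rw [hLHS, sum_DIdx]
  simp only [rowU, colV]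
  by_cases hk : 2 ≤ a.card
  · simp only [hk, if_true, add_zero, zero_mul]
    have hS1 : ∑ i, c₁ n a * udInd a i * (1 - udInd P i) = c₁ n a * ((a.card : ℝ) - (a ∩ P).card) := by
      rw [← sum_udInd_mul_one_sub, Finset.mul_sum]
      exact Finset.sum_congr rfl fun i _ => by ring
    have hS2 : ∑ i, c₂ n a * (1 - udInd a i) * udInd P i = c₂ n a * ((P.card : ℝ) - (a ∩ P).card) := by
      rw [← sum_one_sub_udInd_mul, Finset.mul_sum]
      exact Finset.sum_congr rfl fun i _ => by ring
    have hS3 : ∑ i, max (σ i) 0 * (1 - udInd b i) = ∑ i, max (σ i) 0 - ∑ i, max (σ i) 0 * udInd b i := by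
      rw [← Finset.sum_sub_distrib]
      exact Finset.sum_congr rfl fun i _ => by ring
    rw [← hid a b P, hS1, hS2, hS3, udRow_dotProduct_qOff, mval, c₁, c₂]
    push_cast
    ring
  · simp only [hk, if_false, zero_mul, Finset.sum_const_zero, zero_add]
    have hS3 : ∑ i, (max (σ i) 0 + udInd a i) * (1 - udInd b i)
        = ∑ i, max (σ i) 0 - ∑ i, max (σ i) 0 * udInd b i + ((a.card : ℝ) - (a ∩ b).card) := by
      rw [← sum_udInd_mul_one_sub, ← Finset.sum_sub_distrib, ← Finset.sum_add_distrib]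
      exact Finset.sum_congr rfl fun i _ => by ring
    rw [hS3, udRow_dotProduct_qOff, mval]
    have hk1 : a.card ≤ 1 := by omega
    rcases Nat.le_one_iff_eq_zero_or_eq_one.mp hk1 with h0 | h1
    · have ha : a = ∅ := Finset.card_eq_zero.mp h0
      subst ha
      simp
      ring
    · obtain ⟨i₀, rfl⟩ := Finset.card_eq_one.mp h1
      have htb : (({i₀} ∩ b).card : ℝ) = 0 ∨ (({i₀} ∩ b).card : ℝ) = 1 := by
        by_cases hi : i₀ ∈ b
        · right; rw [Finset.singleton_inter_of_mem hi, Finset.card_singleton]; norm_num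
        · left; rw [Finset.singleton_inter_of_notMem hi, Finset.card_empty]; norm_num
      rw [Finset.card_singleton]
      push_cast
      rcases htb with h | h <;> rw [h] <;> ring

/-! ## §3 The budget of `Q∘` (`xc ≤ 2n`) and the threshold -/
/-- the linear part of `P ↦ q_P`. -/
def qLinO (n : ℕ) : (Fin n → ℝ) →ₗ[ℝ] (Fin (n * n) → ℝ) where
  toFun y p :=
    if (finProdFinEquiv.symm p).1 = (finProdFinEquiv.symm p).2 then 0
    else (n : ℝ) ^ 2 * (-(y (finProdFinEquiv.symm p).1) - y (finProdFinEquiv.symm p).2) + (n : ℝ) * ∑ j, y j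
  map_add' y z := by
    funext p
    simp only [Pi.add_apply, Finset.sum_add_distrib]
    split_ifs <;> ring
  map_smul' c y := by
    funext p
    simp only [Pi.smul_apply, smul_eq_mul, RingHom.id_apply, ← Finset.mul_sum]
    split_ifs <;> ring
/-- the constant part of `P ↦ q_P`. -/
def qConstO (n : ℕ) : Fin (n * n) → ℝ := fun p =>
  if (finProdFinEquiv.symm p).1 = (finProdFinEquiv.symm p).2 then 0 else (n : ℝ) ^ 2
/-- `q_P = L(𝟙_P) + v` entrywise: the vertices of `Q∘` are AFFINE in `𝟙_P`. -/
theorem qOff_eq_affine {n : ℕ} (P : Finset (Fin n)) : qOff P = qLinO n (udInd P) + qConstO n := by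
  funext p
  simp only [qOff, qOffMat, flat, qLinO, qConstO, LinearMap.coe_mk, AddHom.coe_mk, Pi.add_apply, sum_udInd_univ]
  split_ifs with h
  · ring
  · ring

/-- ★ `xc(Q∘) ≤ 2n`: `Q∘` is the image of `[0,1]ⁿ = conv{𝟙_P}` under `y ↦ L y + v`. -/
theorem hasEFOfSize_qOff (n : ℕ) :
    HasEFOfSize (convexHull ℝ (Set.range (qOff : Finset (Fin n) → Fin (n * n) → ℝ))) (n + n) := by
  have h1 := (hasEFOfSize_unitCube n).image_affine (qLinO n) (qConstO n)
  rw [← convexHull_range_udInd] at h1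
  have himg : (fun x => qLinO n x + qConstO n) '' convexHull ℝ (Set.range (udInd : Finset (Fin n) → Fin n → ℝ)) =
      convexHull ℝ (Set.range (qOff : Finset (Fin n) → Fin (n * n) → ℝ)) := by
    let f : (Fin n → ℝ) →ᵃ[ℝ] (Fin (n * n) → ℝ) := (qLinO n).toAffineMap + AffineMap.const ℝ (Fin n → ℝ) (qConstO n)
    have hf : (fun x => qLinO n x + qConstO n) = ⇑f := by funext x; simp [f]
    have hcomp : (⇑f ∘ udInd) = (qOff : Finset (Fin n) → Fin (n * n) → ℝ) := by
      funext P
      rw [Function.comp_apply, ← hf, qOff_eq_affine]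
    rw [hf, AffineMap.image_convexHull, ← Set.range_comp, hcomp]
  rw [himg] at h1
  exact h1
/-- `2n² + 7n + 3 ≤ T 2 n = 2^{(log₂ n + 2)²}`. -/
theorem budget_lt_T_two (n : ℕ) : 2 * n ^ 2 + 7 * n + 3 ≤ 2 ^ ((Nat.log 2 n + 2) ^ 2) := by
  have hlt : n < 2 ^ (Nat.log 2 n + 1) := Nat.lt_pow_succ_log_self (by norm_num) n
  set L := Nat.log 2 n with hL
  have h1 : 2 * n ^ 2 + 7 * n + 3 ≤ 4 * (n + 1) ^ 2 := by nlinarith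
  have h2 : (n + 1) ^ 2 ≤ (2 ^ (L + 1)) ^ 2 := Nat.pow_le_pow_left (by omega) 2
  have h3 : 4 * (2 ^ (L + 1)) ^ 2 = 2 ^ (2 * L + 4) := by ring
  have h4 : 2 ^ (2 * L + 4) ≤ 2 ^ ((L + 2) ^ 2) := Nat.pow_le_pow_right (by norm_num) (by nlinarith)
  omega

/-! ## §4 The law `C⁺_diag` is false -/

/-- ★★ **`diagTilted.Law` (C⁺_diag) is FALSE** — verbatim `CliqueRowBlind.diagTilted.Law`, unfolded (rows `(a, σ)`,
functional `udRow a + flat (diagonal σ)`, right-hand side `1 + Σ_i max(σ_i, 0)`; `T c n = 2^{(log₂ n + c)^c}`). -/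
theorem diagTiltedLaw_false :
    ¬ (∀ c : ℕ, ∃ n₀ : ℕ, ∀ n ≥ n₀, ∀ (K : ℕ) (q : Fin (K + 1) → (Fin (n * n) → ℝ)) (r : ℕ),
        HasEFOfSize (convexHull ℝ (Set.range q)) r →
        ∀ m : Finset (Fin n) × (Fin n → ℝ) → ℝ,
          (∀ a j, (udRow a.1 + flat (Matrix.diagonal a.2)) ⬝ᵥ q j ≤ m a) →
          (∀ a, ∃ j, (udRow a.1 + flat (Matrix.diagonal a.2)) ⬝ᵥ q j = m a) →
        ∀ (U : Finset (Fin n) × (Fin n → ℝ) → Option (Fin r) → ℝ)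
          (V : Finset (Fin n) × Fin (K + 1) → Option (Fin r) → ℝ),
          (∀ a i, 0 ≤ U a i) → (∀ p i, 0 ≤ V p i) →
          (∀ a b j, ((1 + ∑ i, max (a.2 i) 0) + m a) - (udRow a.1 + flat (Matrix.diagonal a.2)) ⬝ᵥ (udPt b + q j)
              = ∑ i, U a i * V (b, j) i) →
          2 ^ ((Nat.log 2 n + c) ^ c) < r) := by
  classical
  intro hL
  obtain ⟨n₀, hn₀⟩ := hL 2
  obtain ⟨n, hnn₀, hn2⟩ : ∃ n, n₀ ≤ n ∧ 2 ≤ n := ⟨max n₀ 2, le_max_left _ _, le_max_right _ _⟩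
  have hK : Fintype.card (Finset (Fin n)) = (Fintype.card (Finset (Fin n)) - 1) + 1 :=
    (Nat.sub_add_cancel Fintype.card_pos).symm
  set K := Fintype.card (Finset (Fin n)) - 1 with hKdef
  let eC : Finset (Fin n) ≃ Fin (K + 1) := Fintype.equivFinOfCardEq hK
  let q : Fin (K + 1) → (Fin (n * n) → ℝ) := fun j => qOff (eC.symm j)
  have hcard : Fintype.card (DIdx n) = Fintype.card (Option (Fin (2 * n ^ 2 + 7 * n + 2))) := by
    rw [card_DIdx, Fintype.card_option, Fintype.card_fin]
  let eS : DIdx n ≃ Option (Fin (2 * n ^ 2 + 7 * n + 2)) := Fintype.equivOfCardEq hcard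
  have hrange : Set.range q = Set.range (qOff : Finset (Fin n) → Fin (n * n) → ℝ) := by
    ext x; constructor
    · rintro ⟨j, rfl⟩; exact ⟨eC.symm j, rfl⟩
    · rintro ⟨P, rfl⟩; exact ⟨eC P, by simp [q]⟩
  have hQ : HasEFOfSize (convexHull ℝ (Set.range q)) (2 * n ^ 2 + 7 * n + 2) := by
    rw [hrange]; exact (hasEFOfSize_qOff n).of_le (by nlinarith)
  obtain ⟨U, V, hU, hV, hfac⟩ := slack_factorization n hn2
  have key := hn₀ n hnn₀ K q (2 * n ^ 2 + 7 * n + 2) hQ (fun a => mval n a.1)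
    (fun a j => by
      show (udRow a.1 + flat (Matrix.diagonal a.2)) ⬝ᵥ qOff (eC.symm j) ≤ mval n a.1
      rw [rho_dotProduct_qOff]
      exact udRow_dotProduct_qOff_le a.1 _)
    (fun a => ⟨eC a.1, by
      show (udRow a.1 + flat (Matrix.diagonal a.2)) ⬝ᵥ qOff (eC.symm (eC a.1)) = mval n a.1
      rw [Equiv.symm_apply_apply, rho_dotProduct_qOff, udRow_dotProduct_qOff_self]⟩)
    (fun a i => U a (eS.symm i)) (fun p i => V (p.1, eC.symm p.2) (eS.symm i))
    (fun a i => hU a _) (fun p i => hV _ _)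
    (fun a b j => by
      show ((1 + ∑ i, max (a.2 i) 0) + mval n a.1) - (udRow a.1 + flat (Matrix.diagonal a.2)) ⬝ᵥ
          (udPt b + qOff (eC.symm j)) = ∑ i, U a (eS.symm i) * V (b, eC.symm j) (eS.symm i)
      rw [hfac a b (eC.symm j)]
      exact (Equiv.sum_comp eS.symm (fun idx => U a idx * V (b, eC.symm j) idx)).symm)
  have hle := budget_lt_T_two n
  omega

end Summit.ValiantsHypothesis.Theorems.NNDivisionHardNegative.DiagTilted
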